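import Summits.CriticalPhenomena.PercolationContinuityZ3.Theorems.SahiMasterFamilyFInequalityKCCutBound

/-!
# `F_comb ≥ 0` on `G ⊆ A ∪ B` for every instance whose link graph is bipartite (unconditional)

Support file for the master-family `F`-inequality programme (`prim-master-conj` gen 27; `--supports stmt-CriticalPhenomena-4575`;
memo `run/shared/lean/prim/prim-l12/prim-master-conj/POINTWISE.md` §28).  No definition, no `sorry`, standard axioms.

`weightedFcomb_nonneg_of_KC_of_subset_union` (`…TwistedMaricaSchonheim`) derives `WF_comb(ω;A,B,G) ≥ 0` for upper `A, B, G` with `G ⊆ A ∪ B`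
from the CONJECTURE `KCWeighted ω` (all pairs `V ⊆ Y`).  Its proof uses (KC) only for the one pair `V = A∩B∩G ⊆ Y = (A∩B) ∪ G`; here that proof is
repeated with the instance inequality as hypothesis:

* `weightedFcomb_nonneg_of_kcAt_of_subset_union` — `ccWeight ω (Y∖V) ≤ 2·ω(V ∖ Yᶜˢ)` for `V = A∩B∩G`, `Y = (A∩B)∪G`  ⟹  `WF_comb(ω;A,B,G) ≥ 0`;

and combined with the unconditional `kc_of_separating_colouring` (`…KCCutBound`):

* `weightedFcomb_nonneg_of_separating_colouring` — **unconditional**: if the comparability components of `T = ((A∩B)∪G) ∖ (A∩B∩G)` admit a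
  colouring separating every cross-component antipodal pair (bipartite link graph), then `WF_comb(ω;A,B,G) ≥ 0` for every complement-invariant
  FKG weight `ω ≥ 0` — in particular all Bernstein coefficients of `F` on such triples.  By the censuses of POINTWISE §26 (V4)(c) the link graph is
  bipartite for EVERY triple in dimension ≤ 5, so this is the structural form of the exhaustive `F_comb(k ≤ 5)` verifications on the class `G ⊆ A ∪ B`;
  the open content is the odd cycles from dimension 6 on.

HONEST FRAMING: unconditional special case + instance-wise reduction for an OPEN conjecture of this programme. [this work]
-/

namespace Summit.CriticalPhenomena.PercolationContinuityZ3.Theorems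

namespace TwistedAD

open Finset
open scoped FinsetFamily Classical

variable {κ : Type*} [Fintype κ] [DecidableEq κ]

/-- **Instance-wise (KC) ⟹ `WF_comb ≥ 0` on the class `G ⊆ A ∪ B`.**  Same statement and proof as `weightedFcomb_nonneg_of_KC_of_subset_union`, but
assuming the (KC) inequality only for the pair `(A∩B∩G, (A∩B)∪G)` that the proof uses. [this work] -/
theorem weightedFcomb_nonneg_of_kcAt_of_subset_union (ω : Finset κ → ℝ) (hω₀ : ∀ s, 0 ≤ ω s) (hsym : ∀ s, ω sᶜ = ω s)
    (A B G : Finset (Finset κ)) (hA : IsUpperSet (A : Set (Finset κ))) (hB : IsUpperSet (B : Set (Finset κ)))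
    (hG : IsUpperSet (G : Set (Finset κ))) (hGAB : G ⊆ A ∪ B)
    (hKCi : ccWeight ω ((A ∩ B ∪ G) \ (A ∩ B ∩ G)) ≤ 2 * ∑ s ∈ (A ∩ B ∩ G) \ (A ∩ B ∪ G)ᶜˢ, ω s) :
    0 ≤ ∑ s, ω s * ((if s ∈ A ∩ B ∩ G then (1 : ℝ) else 0) - (if s ∈ A ∩ G then (1 : ℝ) else 0) * (if sᶜ ∈ B ∩ G then 1 else 0)
              - (if s ∈ G then (1 : ℝ) else 0) * (if sᶜ ∈ (A ∩ B) \ G then 1 else 0)) := by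
  rw [weightedFcomb_eq_kappa_decomposition ω hsym A B G]
  set W : Finset (Finset κ) := A ∩ B with hW
  set V : Finset (Finset κ) := W ∩ G with hV
  set Y : Finset (Finset κ) := W ∪ G with hY
  have hWup : IsUpperSet (W : Set (Finset κ)) := by rw [hW, coe_inter]; exact hA.inter hB
  have hVup : IsUpperSet (V : Set (Finset κ)) := by rw [hV, coe_inter]; exact hWup.inter hG
  have hYup : IsUpperSet (Y : Set (Finset κ)) := by rw [hY, coe_union]; exact hWup.union hG
  have hVY : V ⊆ Y := fun s hs => mem_union.2 (Or.inl (mem_inter.1 hs).1)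
  -- rewrite κ
  have hkap := kappa_eq_coherent_sub ω hsym W G
  -- the decomposition Y \ V = (W \ G) ∪ (G \ W), with no comparabilities across
  have hsplit : Y \ V = (W \ G) ∪ (G \ W) := by
    ext s
    simp only [hY, hV, mem_sdiff, mem_union, mem_inter, not_and]
    tauto
  have hnc : ∀ a ∈ W \ G, ∀ b ∈ G \ W, ¬ (a ⊆ b ∨ b ⊆ a) := by
    intro a ha b hb hab
    rw [mem_sdiff] at ha hb
    rcases hab with hab | hba
    · exact hb.2 (hWup hab ha.1)
    · exact ha.2 (hG hba hb.1)
  -- X₁ points are cross-component in Y \ V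
  have hX1 : ∀ s ∈ (W \ G) ∩ (G \ W)ᶜˢ, s ∈ Y \ V ∧ sᶜ ∈ Y \ V ∧ ¬ SameComp (Y \ V) s sᶜ := by
    intro s hs
    rw [mem_inter, mem_compls] at hs
    refine ⟨by rw [hsplit]; exact mem_union.2 (Or.inl hs.1), by rw [hsplit]; exact mem_union.2 (Or.inr hs.2), ?_⟩
    intro hsame
    rw [hsplit] at hsame
    have := (sameComp_restrict (W \ G) (G \ W) hnc (x := sᶜ) (y := s) (hsame.symm _ _)).1.1 hs.2
    exact (mem_sdiff.1 this).2 (mem_sdiff.1 hs.1).1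
  -- X₂ points (crossing points of (A∩G, B∩G)) are cross-component in Y \ V
  have hCDeq : ((A ∩ G) ∪ (B ∩ G)) \ ((A ∩ G) ∩ (B ∩ G)) = G \ W := by
    ext s
    rw [hW]
    simp only [mem_sdiff, mem_union, mem_inter]
    constructor
    · rintro ⟨h1, h2⟩
      have hsG : s ∈ G := h1.elim (fun h => h.2) (fun h => h.2)
      exact ⟨hsG, fun hab => h2 ⟨⟨hab.1, hsG⟩, ⟨hab.2, hsG⟩⟩⟩
    · rintro ⟨hsG, h2⟩
      refine ⟨?_, fun h1 => h2 ⟨h1.1.1, h1.2.1⟩⟩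
      rcases mem_union.1 (hGAB hsG) with hsA | hsB
      · exact Or.inl ⟨hsA, hsG⟩
      · exact Or.inr ⟨hsB, hsG⟩
  have hC : IsUpperSet ((A ∩ G : Finset (Finset κ)) : Set (Finset κ)) := by rw [coe_inter]; exact hA.inter hG
  have hD : IsUpperSet ((B ∩ G : Finset (Finset κ)) : Set (Finset κ)) := by rw [coe_inter]; exact hB.inter hG
  have hX2 : ∀ s ∈ ((A ∩ G) \ B) ∩ ((B ∩ G) \ A)ᶜˢ, s ∈ Y \ V ∧ sᶜ ∈ Y \ V ∧ ¬ SameComp (Y \ V) s sᶜ := by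
    intro s hs
    rw [mem_inter, mem_compls, mem_sdiff, mem_sdiff, mem_inter, mem_inter] at hs
    obtain ⟨⟨⟨hsA, hsG⟩, hsB⟩, ⟨hcB, hcG⟩, hcA⟩ := hs
    have hsGW : s ∈ G \ W := mem_sdiff.2 ⟨hsG, fun h => hsB (mem_inter.1 h).2⟩
    have hcGW : sᶜ ∈ G \ W := mem_sdiff.2 ⟨hcG, fun h => hcA (mem_inter.1 h).1⟩
    refine ⟨by rw [hsplit]; exact mem_union.2 (Or.inr hsGW), by rw [hsplit]; exact mem_union.2 (Or.inr hcGW), ?_⟩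
    intro hsame
    rw [hsplit] at hsame
    have hres := (sameComp_restrict (W \ G) (G \ W) hnc hsame).2 hsGW
    rw [← hCDeq] at hres
    have := (mem_sdiff_iff_of_sameComp (A ∩ G) (B ∩ G) hC hD hres).1
      (mem_sdiff.2 ⟨mem_inter.2 ⟨hsA, hsG⟩, fun h => hsB (mem_inter.1 h).1⟩)
    exact (mem_sdiff.1 this).2 (mem_inter.2 ⟨hcB, hcG⟩)
  -- the four families X₁, X₁ᶜˢ, X₂, X₂ᶜˢ are pairwise disjoint; their total weight is ≤ ccWeight ω (Y \ V)
  set X1 : Finset (Finset κ) := (W \ G) ∩ (G \ W)ᶜˢ with hX1d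
  set X2 : Finset (Finset κ) := ((A ∩ G) \ B) ∩ ((B ∩ G) \ A)ᶜˢ with hX2d
  set Z : Finset (Finset κ) := (X1 ∪ X1ᶜˢ) ∪ (X2 ∪ X2ᶜˢ) with hZ
  have hZprop : ∀ s ∈ Z, s ∈ Y \ V ∧ sᶜ ∈ Y \ V ∧ ¬ SameComp (Y \ V) s sᶜ := by
    intro s hs
    have hequiv : Equivalence (SameComp (Y \ V)) := Relation.EqvGen.is_equivalence _
    rcases mem_union.1 hs with h1 | h2
    · rcases mem_union.1 h1 with h | h
      · exact hX1 s h
      · have h' := hX1 sᶜ (mem_compls.1 h)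
        rw [compl_compl] at h'
        exact ⟨h'.2.1, h'.1, fun hsame => h'.2.2 (hequiv.symm hsame)⟩
    · rcases mem_union.1 h2 with h | h
      · exact hX2 s h
      · have h' := hX2 sᶜ (mem_compls.1 h)
        rw [compl_compl] at h'
        exact ⟨h'.2.1, h'.1, fun hsame => h'.2.2 (hequiv.symm hsame)⟩
  have hZle : ∑ s ∈ Z, ω s ≤ ccWeight ω (Y \ V) := by
    unfold ccWeight
    have hZsub : Z ⊆ Y \ V := fun s hs => (hZprop s hs).1
    calc ∑ s ∈ Z, ω s = ∑ s ∈ Z, (if sᶜ ∈ Y \ V ∧ ¬ SameComp (Y \ V) s sᶜ then ω s else 0) :=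
          sum_congr rfl fun s hs => by rw [if_pos ⟨(hZprop s hs).2.1, (hZprop s hs).2.2⟩]
      _ ≤ ∑ s ∈ Y \ V, (if sᶜ ∈ Y \ V ∧ ¬ SameComp (Y \ V) s sᶜ then ω s else 0) := by
          refine sum_le_sum_of_subset_of_nonneg hZsub fun s _ _ => ?_
          split_ifs
          · exact hω₀ s
          · exact le_refl _
  -- disjointness and weights of the four pieces
  have hX1out : ∀ s ∈ X1, s ∉ G := fun s hs => (mem_sdiff.1 (mem_inter.1 hs).1).2
  have hX1cin : ∀ s ∈ X1ᶜˢ, s ∈ G := fun s hs => by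
    have := (mem_inter.1 (mem_compls.1 hs)).2; rw [mem_compls, compl_compl] at this; exact (mem_sdiff.1 this).1
  have hX2inA : ∀ s ∈ X2, s ∈ A ∧ s ∈ G ∧ sᶜ ∈ G := fun s hs => by
    have h := mem_inter.1 hs
    exact ⟨(mem_inter.1 (mem_sdiff.1 h.1).1).1, (mem_inter.1 (mem_sdiff.1 h.1).1).2,
      (mem_inter.1 (mem_sdiff.1 (mem_compls.1 h.2)).1).2⟩
  have hX2cninA : ∀ s ∈ X2ᶜˢ, s ∉ A ∧ s ∈ G ∧ sᶜ ∈ G := fun s hs => by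
    have h := mem_inter.1 (mem_compls.1 hs)
    refine ⟨(mem_sdiff.1 (mem_compls.1 h.2)).2 ∘ (fun h' => by rw [compl_compl]; exact h'), ?_, (mem_inter.1 (mem_sdiff.1 h.1).1).2⟩
    have := (mem_inter.1 (mem_sdiff.1 (mem_compls.1 h.2)).1).2; rwa [compl_compl] at this
  have hd1 : Disjoint X1 X1ᶜˢ := disjoint_left.2 fun s h1 h2 => hX1out s h1 (hX1cin s h2)
  have hd2 : Disjoint X2 X2ᶜˢ := disjoint_left.2 fun s h1 h2 => (hX2cninA s h2).1 (hX2inA s h1).1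
  have hd3 : Disjoint (X1 ∪ X1ᶜˢ) (X2 ∪ X2ᶜˢ) := by
    rw [disjoint_left]
    intro s hs1 hs2
    rcases mem_union.1 hs1 with h | h
    · -- s ∉ G but every point of X2 ∪ X2ᶜˢ is in G
      rcases mem_union.1 hs2 with h' | h'
      · exact hX1out s h (hX2inA s h').2.1
      · exact hX1out s h (hX2cninA s h').2.1
    · -- s ∈ X1ᶜˢ : sᶜ ∈ X1 so sᶜ ∉ G, but points of X2 ∪ X2ᶜˢ have sᶜ ∈ G
      have hsc : sᶜ ∉ G := hX1out sᶜ (mem_compls.1 h)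
      rcases mem_union.1 hs2 with h' | h'
      · exact hsc (hX2inA s h').2.2
      · exact hsc (hX2cninA s h').2.2
  have hZsum : ∑ s ∈ Z, ω s = 2 * ∑ s ∈ X1, ω s + 2 * ∑ s ∈ X2, ω s := by
    rw [hZ, sum_union hd3, sum_union hd1, sum_union hd2, sum_compls_eq ω hsym X1, sum_compls_eq ω hsym X2]
    ring
  have hmid : 0 ≤ ∑ s ∈ (A ∩ B ∩ G) ∩ (G \ (A ∪ B))ᶜˢ, ω s := sum_nonneg fun s _ => hω₀ s
  -- assemble: κ = ω(V \ Yᶜˢ) − ω(X1)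
  have hkap' : (∑ s ∈ (A ∩ B) ∩ G, ω s) - ∑ s ∈ (A ∩ B) ∩ Gᶜˢ, ω s = (∑ s ∈ V \ Yᶜˢ, ω s) - ∑ s ∈ X1, ω s := by
    rw [← hW, hkap]
  rw [hkap']
  linarith [hZle, hZsum, hKCi]

/-- **`WF_comb ≥ 0` on `G ⊆ A ∪ B` whenever the link graph is bipartite (unconditional).**  Let `ω ≥ 0` be complement-invariant with the FKG lattice
condition, `A, B, G` upper with `G ⊆ A ∪ B`, `T = ((A∩B)∪G) ∖ (A∩B∩G)`, and let `χ` be constant on the comparability components of `T` and separate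
every cross-component antipodal pair of `T`.  Then
`0 ≤ Σ_s ω s·[𝟙_{A∩B∩G}(s) − 𝟙_{A∩G}(s)𝟙_{B∩G}(sᶜ) − 𝟙_G(s)𝟙_{(A∩B)∖G}(sᶜ)]`. [this work] -/
theorem weightedFcomb_nonneg_of_separating_colouring (ω : Finset κ → ℝ) (hω₀ : ∀ s, 0 ≤ ω s)
    (hω : ∀ s t, ω s * ω t ≤ ω (s ⊓ t) * ω (s ⊔ t)) (hsym : ∀ s, ω sᶜ = ω s)
    (A B G : Finset (Finset κ)) (hA : IsUpperSet (A : Set (Finset κ))) (hB : IsUpperSet (B : Set (Finset κ)))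
    (hG : IsUpperSet (G : Set (Finset κ))) (hGAB : G ⊆ A ∪ B)
    (χ : Finset κ → Bool)
    (hχ : ∀ x ∈ (A ∩ B ∪ G) \ (A ∩ B ∩ G), ∀ z ∈ (A ∩ B ∪ G) \ (A ∩ B ∩ G),
      SameComp ((A ∩ B ∪ G) \ (A ∩ B ∩ G)) x z → χ x = χ z)
    (hsep : ∀ x ∈ (A ∩ B ∪ G) \ (A ∩ B ∩ G), xᶜ ∈ (A ∩ B ∪ G) \ (A ∩ B ∩ G) →
      ¬ SameComp ((A ∩ B ∪ G) \ (A ∩ B ∩ G)) x xᶜ → χ xᶜ ≠ χ x) :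
    0 ≤ ∑ s, ω s * ((if s ∈ A ∩ B ∩ G then (1 : ℝ) else 0) - (if s ∈ A ∩ G then (1 : ℝ) else 0) * (if sᶜ ∈ B ∩ G then 1 else 0)
              - (if s ∈ G then (1 : ℝ) else 0) * (if sᶜ ∈ (A ∩ B) \ G then 1 else 0)) := by
  have hWup : IsUpperSet ((A ∩ B : Finset (Finset κ)) : Set (Finset κ)) := by rw [coe_inter]; exact hA.inter hB
  have hVup : IsUpperSet ((A ∩ B ∩ G : Finset (Finset κ)) : Set (Finset κ)) := by rw [coe_inter]; exact hWup.inter hG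
  have hYup : IsUpperSet ((A ∩ B ∪ G : Finset (Finset κ)) : Set (Finset κ)) := by rw [coe_union]; exact hWup.union hG
  have hKCi := kc_of_separating_colouring ω hω₀ hω hsym (A ∩ B ∩ G) (A ∩ B ∪ G) hVup hYup χ hχ hsep
  exact weightedFcomb_nonneg_of_kcAt_of_subset_union ω hω₀ hsym A B G hA hB hG hGAB hKCi

end TwistedAD

end Summit.CriticalPhenomena.PercolationContinuityZ3.Theorems
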